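import Mathlib
import HarnessLib
import Summits.NavierStokesRegularity.FluidComputer.TriggeredTransferViscosityRobust

/-!
# Door N1-FC: the relaxation preorder on one-shot schemes, and what a reading under a detection
# floor certifies

Cell `ns-blowup`, seat `ns-blowup-fc-prover-2` (g4; D-0074 GROUP C «bridge support»; LADDER-NS rung
N1-FC «η > 1/λ UNIFORMLY IN Re», director-ns «OneShot → Robust under the PREREG's detection floor»).
LABEL: E–C typing / calibration. WHAT THIS IS NOT: not Navier–Stokes evidence — implications between
the OPEN predicates `TriggerScheme.Step` / `StepWithin` / `StepB` / `Transfers` / `TransfersWithin` /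
`TransfersB` / `TransfersWithBudget` of the typed door (`TriggeredTransfer.lean` and its twins) and
elementary real inequalities; no scheme instance, no transfer and no blow-up is asserted; the DNS words
of PREREG-FC-TRIG-1 / -2 (pub-fluidc) are MODEL readings and never enter. Companion:
`TriggeredTransferThreshold.lean` (threshold raising; the dilation round trip).

## Content

* §1 `TriggerScheme.Relaxes 𝒮 𝒯` — «`𝒯` is a RELAXATION of `𝒮`»: the same scale ratio `λ` and the
  same alphabet `F`, and every constant moved in the direction that makes the scheme's demands weaker:
  efficiency floor `η` LOWERED (its own Kelvin axiom `1 < ηλ` kept), threshold `U⋆` RAISED, nest radius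
  `R`, displacement bound `D`, trigger constants `A i`, transfer-time law `(C_τ, q)` ENLARGED, e-fold
  budget `a` and floor constant `c` LOWERED. A preorder (`Relaxes.refl`, `Relaxes.trans`). Every door
  predicate is MONOTONE along it: `Relaxes.isTrigger`, `Relaxes.link` (the data of a step), `Relaxes.step`,
  `Relaxes.stepB`, `Relaxes.stepWithin`, `Relaxes.stepWithinB`, `Relaxes.transfers`, `Relaxes.transfersB`,
  `Relaxes.transfersWithin`, `Relaxes.transfersWithinB`, `Relaxes.transfersWithBudget`.
* §2 Three relaxations as constructors. `withEta η'` (`1 < η'λ`, `η' ≤ η`): **the POSITIVE reading under a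
  detection floor** — a one-shot reading `ηr` of a transfer's efficiency with floor `δ`
  (`|ηr - η_true| ≤ δ`) certifies the amplitude clause `growth · U ≤ U'` of the scheme with efficiency
  floor `ηr - δ` (`growth_withEta_mul_le_of_reading`), which is a scheme iff `1 < λ (ηr - δ)` — the twin
  of the negative reading `GadgetDetectionFloorNoGo.TriggerScheme.false_of_reading` (g3): under a floor
  `δ` the bar a reading must clear is `1/λ + δ`, and what it then certifies is the LOWERED scheme, never
  the nominal one (`Transfers.withEta`: the lowered scheme inherits transfer). `withA A'` (`A ≤ A'`) and
  `inflate M` (`A i ↦ M^i · A i`): trigger constants inflated. `raise U₁`: threshold raised to `max U⋆ U₁`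
  (needs an inhabited amplitude above it).

References: T. Tao, J. Amer. Math. Soc. 29 (2016) 601–674, §1.3 (one-shot transfer, noise tolerance,
the clock) [cite: Tao2016AveragedNS, §1.3]; T. Tao, Anal. PDE 6 (2013) 25–107, footnote 3 (viscosity
normalisation) [cite: Tao2011, footnote 3]. 0 sorry; axioms ⊆ {propext, Classical.choice, Quot.sound}.
-/

noncomputable section

namespace Summit.NavierStokesRegularity.FluidComputer.TriggeredTransfer

open Set MeasureTheory Function
open scoped ENNReal ContDiff NNReal
open Literature.Analysis.FluidPDE
open Literature.Analysis.FluidPDE.FluidComputer (E3 Vel)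

namespace TriggerScheme

/-! ## §1 The relaxation preorder -/

/-- **`𝒯` is a relaxation of `𝒮`**: same scale ratio and alphabet; efficiency floor lowered, threshold
raised, nest radius / displacement bound / trigger constants / transfer-time law enlarged, e-fold budget
and floor constant lowered. Along a relaxation every demand of the door becomes weaker (the direction in
which noise tolerances, larger gates and slower clocks are conceded). [cite: Tao2016AveragedNS, §1.3] -/
structure Relaxes (𝒮 𝒯 : TriggerScheme) : Prop where
  /-- same scale ratio -/
  lam_eq : 𝒯.lam = 𝒮.lam
  /-- same alphabet -/
  F_eq : 𝒯.F = 𝒮.F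
  /-- efficiency floor lowered -/
  eta_le : 𝒯.eta ≤ 𝒮.eta
  /-- threshold raised -/
  UStar_le : 𝒮.UStar ≤ 𝒯.UStar
  /-- nest radius enlarged -/
  R_le : 𝒮.R ≤ 𝒯.R
  /-- floor constant lowered -/
  c_le : 𝒯.c ≤ 𝒮.c
  /-- displacement bound enlarged -/
  D_le : 𝒮.D ≤ 𝒯.D
  /-- trigger constants inflated -/
  A_le : ∀ i, 𝒮.A i ≤ 𝒯.A i
  /-- e-fold budget lowered -/
  a_le : 𝒯.a ≤ 𝒮.a
  /-- transfer-time constant enlarged -/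
  Cτ_le : 𝒮.Cτ ≤ 𝒯.Cτ
  /-- transfer-time exponent enlarged -/
  q_le : 𝒮.q ≤ 𝒯.q

/-- Every scheme is a relaxation of itself. [folklore] -/
theorem Relaxes.refl (𝒮 : TriggerScheme) : 𝒮.Relaxes 𝒮 :=
  ⟨rfl, rfl, le_rfl, le_rfl, le_rfl, le_rfl, le_rfl, fun _ => le_rfl, le_rfl, le_rfl, le_rfl⟩

/-- Relaxation is transitive. [folklore] -/
theorem Relaxes.trans {𝒮 𝒯 𝒰 : TriggerScheme} (h₁ : 𝒮.Relaxes 𝒯) (h₂ : 𝒯.Relaxes 𝒰) :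
    𝒮.Relaxes 𝒰 where
  lam_eq := h₂.lam_eq.trans h₁.lam_eq
  F_eq := h₂.F_eq.trans h₁.F_eq
  eta_le := h₂.eta_le.trans h₁.eta_le
  UStar_le := h₁.UStar_le.trans h₂.UStar_le
  R_le := h₁.R_le.trans h₂.R_le
  c_le := h₂.c_le.trans h₁.c_le
  D_le := h₁.D_le.trans h₂.D_le
  A_le i := (h₁.A_le i).trans (h₂.A_le i)
  a_le := h₂.a_le.trans h₁.a_le
  Cτ_le := h₁.Cτ_le.trans h₂.Cτ_le
  q_le := h₁.q_le.trans h₂.q_le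

namespace Relaxes

variable {𝒮 𝒯 : TriggerScheme} (h : 𝒮.Relaxes 𝒯)
include h

/-- Along a relaxation the amplitude growth factor `(ηλ)^{1/2}` does not increase. [folklore] -/
theorem growth_le : 𝒯.growth ≤ 𝒮.growth := by
  unfold growth
  rw [h.lam_eq]
  exact Real.sqrt_le_sqrt (mul_le_mul_of_nonneg_right h.eta_le 𝒮.lam_pos.le)

/-- The transfer-time law is monotone in `(C_τ, q)` for positive amplitudes (`1 + |log ε| ≥ 1`).
[folklore] -/
theorem timeLaw_le {U ε : ℝ} (hU : 0 < U) :
    𝒮.Cτ * (1 + |Real.log ε|) ^ 𝒮.q / U ≤ 𝒯.Cτ * (1 + |Real.log ε|) ^ 𝒯.q / U := by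
  have h1 : (1 : ℝ) ≤ 1 + |Real.log ε| := le_add_of_nonneg_right (abs_nonneg _)
  have hpow : (1 + |Real.log ε|) ^ 𝒮.q ≤ (1 + |Real.log ε|) ^ 𝒯.q := pow_le_pow_right₀ h1 h.q_le
  refine div_le_div_of_nonneg_right ?_ hU.le
  exact mul_le_mul h.Cτ_le hpow (pow_nonneg (zero_le_one.trans h1) _)
    (𝒮.Cτ_pos.le.trans h.Cτ_le)

/-- The neighbourhoods of the alphabet (tolerance-robust twin) are the same along a relaxation.
[folklore] -/
theorem nbhd_eq (ρ U : ℝ) : 𝒯.nbhd ρ U = 𝒮.nbhd ρ U := by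
  unfold nbhd
  rw [h.F_eq]

/-- **Triggers are monotone**: an admissible trigger of `𝒮` (amplitude `ε ≥ 0`) is one of any
relaxation (larger nest ball, larger shape constants). [folklore] -/
theorem isTrigger {ε δ T : ℝ} {g : ℝ → Vel} (hε : 0 ≤ ε) (hg : 𝒮.IsTrigger ε δ T g) :
    𝒯.IsTrigger ε δ T g where
  smooth := hg.smooth
  off_early := hg.off_early
  off_late := hg.off_late
  off_far t x hx := hg.off_far t x (h.R_le.trans hx)
  small i z := (hg.small i z).trans (mul_le_mul_of_nonneg_left (h.A_le i) hε)

/-- **The data of a step is monotone** (amplitude `U > 0`, seed `ε ≥ 0`): same piece, same trigger,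
same hand-over; the time law, the trigger class, the amplitude clause `growth · U ≤ U'`, the membership
`w' ∈ F U'` and the displacement bound are each weaker for the relaxation. [folklore] -/
def link {ν U ε : ℝ} {w : Vel} (hU : 0 < U) (hε : 0 ≤ ε) (L : 𝒮.Link ν U ε w) : 𝒯.Link ν U ε w where
  T := L.T
  δ := L.δ
  g := L.g
  u := L.u
  p := L.p
  U' := L.U'
  w' := L.w'
  x₀ := L.x₀
  δ_pos := L.δ_pos
  two_δ_lt := L.two_δ_lt
  T_le := L.T_le.trans (h.timeLaw_le hU)
  trigger := h.isTrigger hε L.trigger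
  classical := L.classical
  initial := L.initial
  energy := L.energy
  growth_le := (mul_le_mul_of_nonneg_right h.growth_le hU.le).trans L.growth_le
  mem := by rw [h.F_eq]; exact L.mem
  norm_x₀_le := L.norm_x₀_le.trans h.D_le
  handover := by rw [h.lam_eq]; exact L.handover

/-- **Steps are monotone** along a relaxation (`U > 0`, `ε ≥ 0`). [folklore] -/
theorem step {ν U ε : ℝ} {w : Vel} (hU : 0 < U) (hε : 0 ≤ ε) (hs : 𝒮.Step ν U ε w) :
    𝒯.Step ν U ε w := by
  obtain ⟨L⟩ := 𝒮.step_iff_nonempty_link.1 hs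
  exact 𝒯.step_iff_nonempty_link.2 ⟨h.link hU hε L⟩

/-- **Bounded steps are monotone** along a relaxation (same piece, same ceiling). [folklore] -/
theorem stepB {ν U ε : ℝ} {w : Vel} (hU : 0 < U) (hε : 0 ≤ ε) (hs : 𝒮.StepB ν U ε w) :
    𝒯.StepB ν U ε w := by
  obtain ⟨L, M, hM⟩ := hs
  exact ⟨h.link hU hε L, M, hM⟩

/-- **Tolerance-robust steps are monotone** along a relaxation (same tolerance `ρ`). [folklore] -/
theorem stepWithin {ν U ε ρ : ℝ} {w : Vel} (hU : 0 < U) (hε : 0 ≤ ε)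
    (hs : 𝒮.StepWithin ν U ε w ρ) : 𝒯.StepWithin ν U ε w ρ := by
  obtain ⟨T, δ, g, u, p, hδ, h2δ, hT, hg, hsol, hu0, hE, hdec, U', w', x₀, hgrow, hw', hx₀, hclose⟩ :=
    hs
  refine ⟨T, δ, g, u, p, hδ, h2δ, hT.trans (h.timeLaw_le hU), h.isTrigger hε hg, hsol, hu0, hE, hdec,
    U', w', x₀, (mul_le_mul_of_nonneg_right h.growth_le hU.le).trans hgrow, ?_, hx₀.trans h.D_le,
    fun x => ?_⟩
  · rw [h.F_eq]; exact hw'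
  · rw [h.lam_eq]; exact hclose x

/-- **Tolerance-robust bounded steps are monotone** along a relaxation. [folklore] -/
theorem stepWithinB {ν U ε ρ : ℝ} {w : Vel} (hU : 0 < U) (hε : 0 ≤ ε)
    (hs : 𝒮.StepWithinB ν U ε w ρ) : 𝒯.StepWithinB ν U ε w ρ := by
  obtain ⟨T, δ, g, u, p, hδ, h2δ, hT, hg, hsol, hu0, hE, hdec, hM, U', w', x₀, hgrow, hw', hx₀,
    hclose⟩ := hs
  refine ⟨T, δ, g, u, p, hδ, h2δ, hT.trans (h.timeLaw_le hU), h.isTrigger hε hg, hsol, hu0, hE, hdec,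
    hM, U', w', x₀, (mul_le_mul_of_nonneg_right h.growth_le hU.le).trans hgrow, ?_, hx₀.trans h.D_le,
    fun x => ?_⟩
  · rw [h.F_eq]; exact hw'
  · rw [h.lam_eq]; exact hclose x

/-- **The transfer predicate is monotone**: if `𝒮` transfers at viscosity `ν`, so does every
relaxation — fewer amplitudes (`U ≥ U⋆' ≥ U⋆`), the same members, fewer admissible seeds
(`ν |log ε| ≤ a' U ≤ a U`), weaker steps. [folklore] -/
theorem transfers {ν : ℝ} (hT : 𝒮.Transfers ν) : 𝒯.Transfers ν := by
  intro U hU w hw ε hε hε1 hadm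
  have hU𝒮 : 𝒮.UStar ≤ U := h.UStar_le.trans hU
  have hU0 : 0 < U := 𝒮.UStar_pos.trans_le hU𝒮
  have hw𝒮 : w ∈ 𝒮.F U := by rw [← h.F_eq]; exact hw
  have hadm𝒮 : ν * |Real.log ε| ≤ 𝒮.a * U :=
    hadm.trans (mul_le_mul_of_nonneg_right h.a_le hU0.le)
  exact h.step hU0 hε.le (hT U hU𝒮 w hw𝒮 ε hε hε1 hadm𝒮)

/-- **The bounded transfer predicate is monotone** along a relaxation. [folklore] -/
theorem transfersB {ν : ℝ} (hT : 𝒮.TransfersB ν) : 𝒯.TransfersB ν := by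
  intro U hU w hw ε hε hε1 hadm
  have hU𝒮 : 𝒮.UStar ≤ U := h.UStar_le.trans hU
  have hU0 : 0 < U := 𝒮.UStar_pos.trans_le hU𝒮
  have hw𝒮 : w ∈ 𝒮.F U := by rw [← h.F_eq]; exact hw
  have hadm𝒮 : ν * |Real.log ε| ≤ 𝒮.a * U :=
    hadm.trans (mul_le_mul_of_nonneg_right h.a_le hU0.le)
  exact h.stepB hU0 hε.le (hT U hU𝒮 w hw𝒮 ε hε hε1 hadm𝒮)

/-- **The tolerance-robust transfer predicate is monotone** along a relaxation (same tolerances; the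
neighbourhoods of the alphabet are the same sets). [folklore] -/
theorem transfersWithin {ν ρin ρout : ℝ} (hT : 𝒮.TransfersWithin ν ρin ρout) :
    𝒯.TransfersWithin ν ρin ρout := by
  intro U hU v hv ε hε hε1 hadm
  have hU𝒮 : 𝒮.UStar ≤ U := h.UStar_le.trans hU
  have hU0 : 0 < U := 𝒮.UStar_pos.trans_le hU𝒮
  have hv𝒮 : v ∈ 𝒮.nbhd ρin U := by rw [← h.nbhd_eq]; exact hv
  have hadm𝒮 : ν * |Real.log ε| ≤ 𝒮.a * U :=
    hadm.trans (mul_le_mul_of_nonneg_right h.a_le hU0.le)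
  exact h.stepWithin hU0 hε.le (hT U hU𝒮 v hv𝒮 ε hε hε1 hadm𝒮)

/-- **The tolerance-robust bounded transfer predicate is monotone** along a relaxation. [folklore] -/
theorem transfersWithinB {ν ρin ρout : ℝ} (hT : 𝒮.TransfersWithinB ν ρin ρout) :
    𝒯.TransfersWithinB ν ρin ρout := by
  intro U hU v hv ε hε hε1 hadm
  have hU𝒮 : 𝒮.UStar ≤ U := h.UStar_le.trans hU
  have hU0 : 0 < U := 𝒮.UStar_pos.trans_le hU𝒮
  have hv𝒮 : v ∈ 𝒮.nbhd ρin U := by rw [← h.nbhd_eq]; exact hv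
  have hadm𝒮 : ν * |Real.log ε| ≤ 𝒮.a * U :=
    hadm.trans (mul_le_mul_of_nonneg_right h.a_le hU0.le)
  exact h.stepWithinB hU0 hε.le (hT U hU𝒮 v hv𝒮 ε hε hε1 hadm𝒮)

/-- **Affine error budgets are monotone** along a relaxation (same keys `amp`, `leak`; fewer input
tolerances owed since `c' ≤ c`). [folklore] -/
theorem transfersWithBudget {ν amp leak : ℝ} (hT : 𝒮.TransfersWithBudget ν amp leak) :
    𝒯.TransfersWithBudget ν amp leak :=
  fun ρ hρ hρc => h.transfersWithin (hT ρ hρ (hρc.trans_le h.c_le))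

end Relaxes

/-! ## §2 Three relaxations: lowering the efficiency floor, inflating the trigger constants,
raising the threshold -/

variable (𝒮 : TriggerScheme)

/-- **The scheme with efficiency floor lowered to `η'`** (`1 < η'λ` — its own Kelvin axiom — and
`η' ≤ η`); everything else unchanged. [folklore] -/
def withEta (η' : ℝ) (hK : 1 < η' * 𝒮.lam) (hle : η' ≤ 𝒮.eta) : TriggerScheme :=
  { 𝒮 with
    eta := η'
    kelvin := hK
    eta_le_one := hle.trans 𝒮.eta_le_one }

/-- **The scheme with trigger constants inflated to `A' ≥ A`**; everything else unchanged. [folklore] -/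
def withA (A' : ℕ → ℝ) (hA : ∀ i, 𝒮.A i ≤ A' i) : TriggerScheme :=
  { 𝒮 with
    A := A'
    A_nonneg := fun i => (𝒮.A_nonneg i).trans (hA i) }

/-- **The scheme with trigger constants inflated geometrically, `A i ↦ M^i · A i`** (`M ≥ 1`).
[folklore] -/
def inflate (M : ℝ) (hM : 1 ≤ M) : TriggerScheme :=
  𝒮.withA (fun i => M ^ i * 𝒮.A i) fun i => le_mul_of_one_le_left (𝒮.A_nonneg i) (one_le_pow₀ hM)

/-- **The scheme with threshold raised to `max U⋆ U₁`** (its alphabet must be inhabited at some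
amplitude above the new threshold — the ignition axiom); everything else unchanged. [folklore] -/
def raise (U₁ : ℝ) (hseed : ∃ U, 𝒮.UStar ≤ U ∧ U₁ ≤ U ∧ (𝒮.F U).Nonempty) : TriggerScheme :=
  { 𝒮 with
    UStar := max 𝒮.UStar U₁
    UStar_pos := lt_max_of_lt_left 𝒮.UStar_pos
    clay := fun U hU w hw => 𝒮.clay U ((le_max_left _ _).trans hU) w hw
    floor := fun U hU w hw => 𝒮.floor U ((le_max_left _ _).trans hU) w hw
    seed := by
      obtain ⟨U, h₁, h₂, h₃⟩ := hseed
      exact ⟨U, max_le h₁ h₂, h₃⟩ }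

section Fields

variable {η' : ℝ} (hK : 1 < η' * 𝒮.lam) (hle : η' ≤ 𝒮.eta)
variable {A' : ℕ → ℝ} (hA : ∀ i, 𝒮.A i ≤ A' i) {M : ℝ} (hM : 1 ≤ M)
variable {U₁ : ℝ} (hseed : ∃ U, 𝒮.UStar ≤ U ∧ U₁ ≤ U ∧ (𝒮.F U).Nonempty)

/-- The lowered efficiency floor. [folklore] -/
@[simp] theorem withEta_eta : (𝒮.withEta η' hK hle).eta = η' := rfl
/-- Lowering the floor keeps the scale ratio. [folklore] -/
@[simp] theorem withEta_lam : (𝒮.withEta η' hK hle).lam = 𝒮.lam := rfl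
/-- The growth factor of the lowered scheme is `(η'λ)^{1/2}`. [folklore] -/
theorem withEta_growth : (𝒮.withEta η' hK hle).growth = Real.sqrt (η' * 𝒮.lam) := rfl
/-- The inflated trigger constants. [folklore] -/
@[simp] theorem withA_A (i : ℕ) : (𝒮.withA A' hA).A i = A' i := rfl
/-- The geometrically inflated trigger constants. [folklore] -/
@[simp] theorem inflate_A (i : ℕ) : (𝒮.inflate M hM).A i = M ^ i * 𝒮.A i := rfl
/-- The raised threshold. [folklore] -/
@[simp] theorem raise_UStar : (𝒮.raise U₁ hseed).UStar = max 𝒮.UStar U₁ := rfl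
/-- The raised threshold is at least `U₁`. [folklore] -/
theorem le_raise_UStar : U₁ ≤ (𝒮.raise U₁ hseed).UStar := le_max_right _ _

/-- Lowering the efficiency floor is a relaxation. [folklore] -/
theorem relaxes_withEta : 𝒮.Relaxes (𝒮.withEta η' hK hle) :=
  ⟨rfl, rfl, hle, le_rfl, le_rfl, le_rfl, le_rfl, fun _ => le_rfl, le_rfl, le_rfl, le_rfl⟩

/-- Inflating the trigger constants is a relaxation. [folklore] -/
theorem relaxes_withA : 𝒮.Relaxes (𝒮.withA A' hA) :=
  ⟨rfl, rfl, le_rfl, le_rfl, le_rfl, le_rfl, le_rfl, hA, le_rfl, le_rfl, le_rfl⟩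

/-- Geometric inflation of the trigger constants is a relaxation. [folklore] -/
theorem relaxes_inflate : 𝒮.Relaxes (𝒮.inflate M hM) :=
  𝒮.relaxes_withA _

/-- Raising the threshold is a relaxation. [folklore] -/
theorem relaxes_raise : 𝒮.Relaxes (𝒮.raise U₁ hseed) :=
  ⟨rfl, rfl, le_rfl, le_max_left _ _, le_rfl, le_rfl, le_rfl, fun _ => le_rfl, le_rfl, le_rfl, le_rfl⟩

end Fields

variable {𝒮}

/-- **The POSITIVE reading under a detection floor (amplitude clause).** If a transfer from amplitude
`U ≥ 0` hands over at amplitude `U' ≥ (η_true λ)^{1/2} U`, and a one-shot instrument reads its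
efficiency as `ηr` with detection floor `δ` (`|ηr - η_true| ≤ δ`), then the hand-over meets the
amplitude clause of the scheme with efficiency floor LOWERED to `ηr - δ` — whenever that is a scheme
at all, i.e. `1 < λ (ηr - δ)` (Kelvin) and `ηr - δ ≤ η`. Under a floor `δ` a reading certifies the
lowered scheme, never the nominal one; the bar it must clear is `1/λ + δ` (twin of
`GadgetDetectionFloorNoGo.TriggerScheme.false_of_reading`). [folklore] -/
theorem growth_withEta_mul_le_of_reading {η ηr δ U U' : ℝ} (hU : 0 ≤ U) (hread : |ηr - η| ≤ δ)
    (htrue : Real.sqrt (η * 𝒮.lam) * U ≤ U') (hK : 1 < (ηr - δ) * 𝒮.lam) (hle : ηr - δ ≤ 𝒮.eta) :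
    (𝒮.withEta (ηr - δ) hK hle).growth * U ≤ U' := by
  rw [withEta_growth]
  have hηle : ηr - δ ≤ η := by linarith [(abs_le.1 hread).2]
  have hsqrt : Real.sqrt ((ηr - δ) * 𝒮.lam) ≤ Real.sqrt (η * 𝒮.lam) :=
    Real.sqrt_le_sqrt (mul_le_mul_of_nonneg_right hηle 𝒮.lam_pos.le)
  exact (mul_le_mul_of_nonneg_right hsqrt hU).trans htrue

/-- **A reading under a detection floor names a scheme iff it clears `1/λ + δ`.** With
`|ηr - η| ≤ δ`: if `1 < λ (ηr - δ)` then the Kelvin axiom `1 < ηλ` of the nominal efficiency holds too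
(the positive reading, cf. `GadgetDetectionFloor.kicked_floor_of_reading` for the gadget spec sheet).
[folklore] -/
theorem one_lt_eta_mul_lam_of_reading {η ηr δ lam : ℝ} (hlam : 0 < lam) (hread : |ηr - η| ≤ δ)
    (hK : 1 < (ηr - δ) * lam) : 1 < η * lam := by
  have hηle : ηr - δ ≤ η := by linarith [(abs_le.1 hread).2]
  exact hK.trans_le (mul_le_mul_of_nonneg_right hηle hlam.le)

/-- **What the lowered scheme inherits.** If `𝒮` transfers (resp. robustly, with ceilings, with a
budget) then so does `𝒮.withEta η'` for every admissible lowered floor `η'`. [folklore] -/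
theorem Transfers.withEta {ν η' : ℝ} (hT : 𝒮.Transfers ν) (hK : 1 < η' * 𝒮.lam) (hle : η' ≤ 𝒮.eta) :
    (𝒮.withEta η' hK hle).Transfers ν :=
  (𝒮.relaxes_withEta hK hle).transfers hT

end TriggerScheme

end Summit.NavierStokesRegularity.FluidComputer.TriggeredTransfer

end
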